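import Literature.AlgebraicGeometry.HodgeTheory.BettiUniverseHodgeRiemannDegreeOneHolds
import Literature.AlgebraicGeometry.HodgeTheory.BettiUniverseNormalisedTrace
import HarnessLib

/-!
# The Hodge–Riemann HERMITIAN FORM on `H¹(X(ℂ); ℂ)` of a smooth projective surface with a rational Kähler class,
# ω-normalised: positive definite, Hermitian, and EXACTLY functorial under morphisms pulling the class back

Topic `AlgebraicGeometry/HodgeTheory`, Betti-universe vocabulary (`bettiCohomology`, `cup`, `trC`, `hodge hHD hX k`,
`Motives.HodgeStructure.conj`).  KERNEL ONLY: theorems; no definition, no named fact, no `sorry`.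

For `X/ℂ` smooth projective of dimension `2` and `ω ∈ H²(X(ℂ); ℚ)` with Kähler complexification, the weight-one Hodge
structure `H¹ = F¹ ⊕ conj F¹` ([VoisinHodgeI2002, §7.1.1]; tree `HodgeStructure.isCompl_F_complexConj`) carries the form
    `B^ω_X(α, β) := i · t_ω(β^{1,0} ∪ conj(α^{1,0}) ∪ ω) − i · t_ω(β^{0,1} ∪ conj(α^{0,1}) ∪ ω)`,   `t_ω(η) := tr(η) / tr(ω ∪ ω)`
(`α = α^{1,0} + α^{0,1}` the Hodge decomposition; `tr` the light trace `trC` — any non-zero multiple of `∫_X`, invisible in the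
quotient `t_ω`).  It is conjugate-linear in `α`, linear in `β` (Mathlib's inner-product convention `→ₗ⋆[ℂ]`), HERMITIAN, and
POSITIVE DEFINITE by the Hodge–Riemann bilinear relations in degree one WITH SIGN ([VoisinHodgeI2002, §6.3.2 Thm. 6.32 at `k = 1`]:
`i ∫ α ∧ ᾱ ∧ ω > 0` on `H^{1,0}`, `−i ∫ α ∧ ᾱ ∧ ω > 0` on `H^{0,1}`; tree `BettiUniverse.HodgeRiemann10_holds`, divided by the
volume `∫ ω² > 0`, tree `trC_cup_self_ne_zero_of_isKaehlerClass`).  Being NORMALISED by `tr(ω ∪ ω)`, it is EXACTLY preserved by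
every morphism `g : X' ⟶ X` of smooth projective surfaces for the pulled-back class `g^*ω` (tree `trC_pull_div_eq`: the degree of
`g` cancels; `g^*` is a morphism of Hodge structures, `pull_hodge`, and of cup-product algebras, `pull_cup`).

We state everything WITHOUT a definition: a sesquilinear form `B` «is the Hodge–Riemann form of `(X, ω)`» when it satisfies the
displayed formula on decomposed vectors (the characterisation `IsHRFormOne`-shape spelled out inline in each statement).

* `exists_hrFormOne` — existence of a sesquilinear `B` with the characterisation;
* `hrFormOne_symm` — any such `B` is Hermitian: `B α β = conj (B β α)`;
* `hrFormOne_posDef` — any such `B` is positive definite: `0 < re (B α α)` for `α ≠ 0`;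
* `hrFormOne_pull` — functoriality: `B_{X', g^*ω} (g^*α) (g^*β) = B_{X, ω} α β`;
* `exists_hermitian_posDef_hrFormOne` — the package.
Consumer: the hodgecm-mathlib cell, binder `h413`, junction J1 (b) `StubUnitarizableAtPin` (component forms on the Picard modular
surfaces `P_h`; the level ∕ tower assembly is `A3Liu413TowerFormGlue` (b4) and the class-sum (b6)).

## References
* [VoisinHodgeI2002] C. Voisin, *Hodge Theory and Complex Algebraic Geometry I*, CUP 2002: §6.3.2 Thm. 6.32 (k = 1), Rem. 6.33;
  §7.1.1 (Hodge decomposition `F^p ⊕ conj F^{k−p+1}`); §7.3.2 (pull-back is a morphism of Hodge structures).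
* [HatcherAT2002] A. Hatcher, *Algebraic Topology*, §3.2 Prop. 3.10 (naturality of cup), Thm. 3.11 (graded commutativity).
* Tree: `BettiUniverseAxioms` (`cup`, `pull_cup`, `cup_comm_one`, `trC`, `hodge`, `pull_hodge`), `BettiUniverseHodgeRiemannDegreeOne[Holds]`
  (`HodgeRiemann10`, `HodgeRiemann10_holds`, `hodgeRiemann_one_zero`), `BettiUniverseNormalisedTrace` (`trC_pull_div_eq`,
  `trC_cup_self_ne_zero_of_isKaehlerClass`), `Motives/HodgeStructure` (`conj`, `complexConj`, `isCompl_F_complexConj`).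
-/

noncomputable section

open scoped TensorProduct ComplexConjugate
open Literature.AlgebraicGeometry.Motives (bettiCohomology)
open Literature.AlgebraicTopology.SingularHomology

namespace Literature.AlgebraicGeometry.HodgeTheory

namespace BettiUniverse

variable {n m : ℕ} {X X' : Motives.SchemeOver ℂ}

/-! ## §0 Algebra of `conj`, `∪` and `tr` on the complexification -/

/-- `conj (x ∪ y) = conj x ∪ conj y` for the complexified cup product (the cup product is defined over `ℚ`).
[cite: HatcherAT2002, §3.2 Prop. 3.10] -/
theorem conj_cupC (k : ℕ) (x y : ℂ ⊗[ℚ] bettiCohomology X k) :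
    Motives.HodgeStructure.conj (LinearMap.BilinMap.baseChange ℂ (cup X k k) x y) =
      LinearMap.BilinMap.baseChange ℂ (cup X k k) (Motives.HodgeStructure.conj x) (Motives.HodgeStructure.conj y) := by
  induction x using TensorProduct.induction_on with
  | zero => simp
  | tmul a u =>
    induction y using TensorProduct.induction_on with
    | zero => simp
    | tmul b v =>
      rw [LinearMap.BilinMap.baseChange_tmul, Motives.HodgeStructure.conj_tmul, Motives.HodgeStructure.conj_tmul,
        Motives.HodgeStructure.conj_tmul, LinearMap.BilinMap.baseChange_tmul, map_mul]
    | add y₁ y₂ h₁ h₂ => simp only [map_add, h₁, h₂]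
  | add x₁ x₂ h₁ h₂ => simp only [map_add, LinearMap.add_apply, h₁, h₂]

/-- Anticommutativity of the complexified cup product in degree one: `a ∪ b = −(b ∪ a)` on `ℂ ⊗_ℚ H¹(X(ℂ); ℚ)`.
[cite: HatcherAT2002, §3.2 Thm. 3.11] -/
theorem cupC_comm_one (a b : ℂ ⊗[ℚ] bettiCohomology X 1) :
    LinearMap.BilinMap.baseChange ℂ (cup X 1 1) a b = -LinearMap.BilinMap.baseChange ℂ (cup X 1 1) b a := by
  induction a using TensorProduct.induction_on with
  | zero => simp
  | tmul s u =>
    induction b using TensorProduct.induction_on with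
    | zero => simp
    | tmul t v =>
      rw [LinearMap.BilinMap.baseChange_tmul, LinearMap.BilinMap.baseChange_tmul, cup_comm_one u v, TensorProduct.tmul_neg,
        mul_comm]
    | add y₁ y₂ h₁ h₂ => simp only [map_add, LinearMap.add_apply, h₁, h₂, neg_add]
  | add x₁ x₂ h₁ h₂ => simp only [map_add, LinearMap.add_apply, h₁, h₂, neg_add]

/-- Naturality of the complexified cup product under pull-back: `g^*(x ∪ y) = g^*x ∪ g^*y` on `ℂ ⊗_ℚ H^k` (`pull_cup`,
base-changed). [cite: HatcherAT2002, §3.2 Prop. 3.10] -/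
theorem pullC_cupC (g : X' ⟶ X) (k : ℕ) (x y : ℂ ⊗[ℚ] bettiCohomology X k) :
    (pull g (k + k)).baseChange ℂ (LinearMap.BilinMap.baseChange ℂ (cup X k k) x y) =
      LinearMap.BilinMap.baseChange ℂ (cup X' k k) ((pull g k).baseChange ℂ x) ((pull g k).baseChange ℂ y) := by
  induction x using TensorProduct.induction_on with
  | zero => simp
  | tmul a u =>
    induction y using TensorProduct.induction_on with
    | zero => simp
    | tmul b v =>
      rw [LinearMap.BilinMap.baseChange_tmul, LinearMap.baseChange_tmul, LinearMap.baseChange_tmul, LinearMap.baseChange_tmul,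
        LinearMap.BilinMap.baseChange_tmul, pull_cup]
    | add y₁ y₂ h₁ h₂ => simp only [map_add, h₁, h₂]
  | add x₁ x₂ h₁ h₂ => simp only [map_add, LinearMap.add_apply, h₁, h₂]

/-- The complexified light trace commutes with complex conjugation: `tr (conj η) = conj (tr η)` (the trace is defined over `ℚ`).
[cite: HatcherAT2002, §3.3 Cor. 3.37] -/
theorem trC_conj (hX : Motives.IsSmoothProjective n X) (k : ℕ) (η : ℂ ⊗[ℚ] bettiCohomology X k) :
    trC hX k (Motives.HodgeStructure.conj η) = conj (trC hX k η) := by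
  induction η using TensorProduct.induction_on with
  | zero => simp
  | tmul a u =>
    rw [Motives.HodgeStructure.conj_tmul]
    simp only [LinearMap.coe_comp, LinearEquiv.coe_coe, Function.comp_apply, LinearMap.baseChange_tmul,
      TensorProduct.AlgebraTensorModule.rid_tmul]
    rw [Rat.smul_def, Rat.smul_def, map_mul]
    congr 1
    exact (Complex.conj_ofReal _).symm.trans (by norm_cast)
  | add x y hx hy => rw [map_add, map_add, hx, hy, map_add, map_add]

/-- `conj (1 ⊗ ω) = 1 ⊗ ω`: complexified RATIONAL classes are real (the real structure of the complexification,
[Deligne, Hodge II, 2.1.4]). [cite: VoisinHodgeI2002, §7.1.1] -/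
theorem conj_one_tmul {k : ℕ} (ω : bettiCohomology X k) :
    Motives.HodgeStructure.conj ((1 : ℂ) ⊗ₜ[ℚ] ω) = (1 : ℂ) ⊗ₜ[ℚ] ω := by
  rw [Motives.HodgeStructure.conj_tmul, map_one]

/-- `tr((1 ⊗ ω) ∪ (1 ⊗ ω))` is real (fixed by `conj`): the self-intersection number of a rational class.
[cite: HatcherAT2002, §3.3 Cor. 3.37] -/
theorem conj_trC_cup_one_tmul (hX : Motives.IsSmoothProjective 2 X) (ω : bettiCohomology X 2) :
    conj (trC hX 4 (LinearMap.BilinMap.baseChange ℂ (cup X 2 2) ((1 : ℂ) ⊗ₜ[ℚ] ω) ((1 : ℂ) ⊗ₜ[ℚ] ω))) =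
      trC hX 4 (LinearMap.BilinMap.baseChange ℂ (cup X 2 2) ((1 : ℂ) ⊗ₜ[ℚ] ω) ((1 : ℂ) ⊗ₜ[ℚ] ω)) := by
  rw [← trC_conj hX 4, conj_cupC 2, conj_one_tmul]

/-! ## §1 The Hodge decomposition in degree one -/

/-- `ℂ ⊗_ℚ H¹(X(ℂ); ℚ) = F¹ ⊕ conj F¹` for the weight-one Hodge structure `hodge hHD hX 1` (Hodge decomposition,
`H^{1,0} ⊕ H^{0,1}`). [cite: VoisinHodgeI2002, §7.1.1] -/
theorem isCompl_F_one_conj (hHD : exists_isReal_hodgeModel) (hX : Motives.IsSmoothProjective n X) :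
    IsCompl ((hodge hHD hX 1).F 1) (Motives.HodgeStructure.complexConj ((hodge hHD hX 1).F 1)) :=
  (hodge hHD hX 1).isCompl_F_complexConj 1 1 (by norm_num)

/-- Every vector decomposes along `F¹ ⊕ conj F¹` (Hodge decomposition in degree one). [cite: VoisinHodgeI2002, §7.1.1] -/
theorem exists_decomp_one (hHD : exists_isReal_hodgeModel) (hX : Motives.IsSmoothProjective n X) (α : ℂ ⊗[ℚ] bettiCohomology X 1) :
    ∃ α₁ α₂, α₁ ∈ (hodge hHD hX 1).F 1 ∧ α₂ ∈ Motives.HodgeStructure.complexConj ((hodge hHD hX 1).F 1) ∧ α = α₁ + α₂ := by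
  obtain ⟨u, v, huv, -⟩ := Submodule.existsUnique_add_of_isCompl (isCompl_F_one_conj hHD hX) α
  exact ⟨u, v, u.2, v.2, huv.symm⟩

/-! ## §2 The ω-normalised Hodge–Riemann form: existence with its characterisation -/

/-- **Existence of the ω-normalised Hodge–Riemann sesquilinear form on `H¹(X(ℂ); ℂ)`** with its CHARACTERISATION on Hodge-decomposed
vectors: for `α = α₁ + α₂`, `β = β₁ + β₂` with `α₁, β₁ ∈ F¹ = H^{1,0}` and `α₂, β₂ ∈ conj F¹ = H^{0,1}`,
`B α β = i·tr(β₁ ∪ conj α₁ ∪ ω)/tr(ω ∪ ω) − i·tr(β₂ ∪ conj α₂ ∪ ω)/tr(ω ∪ ω)` (conjugate-linear in `α`, linear in `β`).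
The construction composes the Hodge projections (`Submodule.projection` of the decomposition `F¹ ⊕ conj F¹`) with the
complexified cup products and the light trace. [cite: VoisinHodgeI2002, §6.3.2 Thm. 6.32 and §7.1.1] -/
theorem exists_hrFormOne (hHD : exists_isReal_hodgeModel) (hX : Motives.IsSmoothProjective 2 X) (ω : bettiCohomology X 2) :
    ∃ B : (ℂ ⊗[ℚ] bettiCohomology X 1) →ₗ⋆[ℂ] (ℂ ⊗[ℚ] bettiCohomology X 1) →ₗ[ℂ] ℂ,
      ∀ (α₁ β₁ α₂ β₂ : ℂ ⊗[ℚ] bettiCohomology X 1), α₁ ∈ (hodge hHD hX 1).F 1 → β₁ ∈ (hodge hHD hX 1).F 1 →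
        α₂ ∈ Motives.HodgeStructure.complexConj ((hodge hHD hX 1).F 1) →
        β₂ ∈ Motives.HodgeStructure.complexConj ((hodge hHD hX 1).F 1) →
        B (α₁ + α₂) (β₁ + β₂) =
          Complex.I * (trC hX 4 (LinearMap.BilinMap.baseChange ℂ (cup X 2 2)
              (LinearMap.BilinMap.baseChange ℂ (cup X 1 1) β₁ (Motives.HodgeStructure.conj α₁)) ((1 : ℂ) ⊗ₜ[ℚ] ω)) /
            trC hX 4 (LinearMap.BilinMap.baseChange ℂ (cup X 2 2) ((1 : ℂ) ⊗ₜ[ℚ] ω) ((1 : ℂ) ⊗ₜ[ℚ] ω))) -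
          Complex.I * (trC hX 4 (LinearMap.BilinMap.baseChange ℂ (cup X 2 2)
              (LinearMap.BilinMap.baseChange ℂ (cup X 1 1) β₂ (Motives.HodgeStructure.conj α₂)) ((1 : ℂ) ⊗ₜ[ℚ] ω)) /
            trC hX 4 (LinearMap.BilinMap.baseChange ℂ (cup X 2 2) ((1 : ℂ) ⊗ₜ[ℚ] ω) ((1 : ℂ) ⊗ₜ[ℚ] ω))) := by
  classical
  -- the two Hodge projections
  have hc := isCompl_F_one_conj hHD hX
  let P : (ℂ ⊗[ℚ] bettiCohomology X 1) →ₗ[ℂ] (ℂ ⊗[ℚ] bettiCohomology X 1) :=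
    ((hodge hHD hX 1).F 1).projection (Motives.HodgeStructure.complexConj ((hodge hHD hX 1).F 1)) hc
  let Q : (ℂ ⊗[ℚ] bettiCohomology X 1) →ₗ[ℂ] (ℂ ⊗[ℚ] bettiCohomology X 1) :=
    (Motives.HodgeStructure.complexConj ((hodge hHD hX 1).F 1)).projection ((hodge hHD hX 1).F 1) hc.symm
  -- the two quadratic pieces as functions
  let c : ℂ := trC hX 4 (LinearMap.BilinMap.baseChange ℂ (cup X 2 2) ((1 : ℂ) ⊗ₜ[ℚ] ω) ((1 : ℂ) ⊗ₜ[ℚ] ω))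
  let T : (ℂ ⊗[ℚ] bettiCohomology X 1) → (ℂ ⊗[ℚ] bettiCohomology X 1) → ℂ := fun γ β =>
    trC hX 4 (LinearMap.BilinMap.baseChange ℂ (cup X 2 2)
      (LinearMap.BilinMap.baseChange ℂ (cup X 1 1) β γ) ((1 : ℂ) ⊗ₜ[ℚ] ω))
  have hT_add_left : ∀ γ γ' β, T (γ + γ') β = T γ β + T γ' β := by
    intro γ γ' β
    simp only [T, map_add, LinearMap.add_apply]
  have hT_smul_left : ∀ (s : ℂ) γ β, T (s • γ) β = s * T γ β := by
    intro s γ β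
    simp only [T, map_smul, LinearMap.smul_apply, smul_eq_mul]
  have hT_add_right : ∀ γ β β', T γ (β + β') = T γ β + T γ β' := by
    intro γ β β'
    simp only [T, map_add, LinearMap.add_apply]
  have hT_smul_right : ∀ (s : ℂ) γ β, T γ (s • β) = s * T γ β := by
    intro s γ β
    simp only [T, map_smul, LinearMap.smul_apply, smul_eq_mul]
  let f : (ℂ ⊗[ℚ] bettiCohomology X 1) → (ℂ ⊗[ℚ] bettiCohomology X 1) → ℂ := fun α β =>
    Complex.I * (T (Motives.HodgeStructure.conj (P α)) (P β) / c) -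
      Complex.I * (T (Motives.HodgeStructure.conj (Q α)) (Q β) / c)
  refine ⟨LinearMap.mk₂'ₛₗ (starRingEnd ℂ) (RingHom.id ℂ) f ?_ ?_ ?_ ?_, ?_⟩
  · intro α α' β
    simp only [f, map_add, hT_add_left]
    ring
  · intro s α β
    simp only [f, map_smul, Motives.HodgeStructure.conj_smul, hT_smul_left]
    ring
  · intro α β β'
    simp only [f, map_add, hT_add_right]
    ring
  · intro s α β
    simp only [f, map_smul, hT_smul_right, RingHom.id_apply]
    ring
  · intro α₁ β₁ α₂ β₂ hα₁ hβ₁ hα₂ hβ₂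
    have hPα : P (α₁ + α₂) = α₁ := by
      rw [map_add, Submodule.projection_apply_of_mem_left hc hα₁, Submodule.projection_apply_of_mem_right hc hα₂, add_zero]
    have hPβ : P (β₁ + β₂) = β₁ := by
      rw [map_add, Submodule.projection_apply_of_mem_left hc hβ₁, Submodule.projection_apply_of_mem_right hc hβ₂, add_zero]
    have hQα : Q (α₁ + α₂) = α₂ := by
      rw [map_add, Submodule.projection_apply_of_mem_right hc.symm hα₁, Submodule.projection_apply_of_mem_left hc.symm hα₂,
        zero_add]
    have hQβ : Q (β₁ + β₂) = β₂ := by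
      rw [map_add, Submodule.projection_apply_of_mem_right hc.symm hβ₁, Submodule.projection_apply_of_mem_left hc.symm hβ₂,
        zero_add]
    rw [LinearMap.mk₂'ₛₗ_apply]
    simp only [f, hPα, hPβ, hQα, hQβ, T, c]

/-! ## §3 Properties of ANY form with the characterisation -/

section Properties

variable {hHD : exists_isReal_hodgeModel} (hX : Motives.IsSmoothProjective 2 X) (ω : bettiCohomology X 2)
  {B : (ℂ ⊗[ℚ] bettiCohomology X 1) →ₗ⋆[ℂ] (ℂ ⊗[ℚ] bettiCohomology X 1) →ₗ[ℂ] ℂ}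
  (hB : ∀ (α₁ β₁ α₂ β₂ : ℂ ⊗[ℚ] bettiCohomology X 1), α₁ ∈ (hodge hHD hX 1).F 1 → β₁ ∈ (hodge hHD hX 1).F 1 →
    α₂ ∈ Motives.HodgeStructure.complexConj ((hodge hHD hX 1).F 1) →
    β₂ ∈ Motives.HodgeStructure.complexConj ((hodge hHD hX 1).F 1) →
    B (α₁ + α₂) (β₁ + β₂) =
      Complex.I * (trC hX 4 (LinearMap.BilinMap.baseChange ℂ (cup X 2 2)
          (LinearMap.BilinMap.baseChange ℂ (cup X 1 1) β₁ (Motives.HodgeStructure.conj α₁)) ((1 : ℂ) ⊗ₜ[ℚ] ω)) /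
        trC hX 4 (LinearMap.BilinMap.baseChange ℂ (cup X 2 2) ((1 : ℂ) ⊗ₜ[ℚ] ω) ((1 : ℂ) ⊗ₜ[ℚ] ω))) -
      Complex.I * (trC hX 4 (LinearMap.BilinMap.baseChange ℂ (cup X 2 2)
          (LinearMap.BilinMap.baseChange ℂ (cup X 1 1) β₂ (Motives.HodgeStructure.conj α₂)) ((1 : ℂ) ⊗ₜ[ℚ] ω)) /
        trC hX 4 (LinearMap.BilinMap.baseChange ℂ (cup X 2 2) ((1 : ℂ) ⊗ₜ[ℚ] ω) ((1 : ℂ) ⊗ₜ[ℚ] ω))))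
include hB

omit hB in
/-- The basic quadratic expression `q(γ, β) := tr(β ∪ conj γ ∪ ω)` satisfies `conj q(γ, β) = − q(β, γ)`
(conjugation commutes with `tr` and `∪`, `ω` is real, degree-one classes anticommute). [cite: HatcherAT2002, §3.2 Thm. 3.11] -/
theorem conj_trC_cup_cup_conj (γ β : ℂ ⊗[ℚ] bettiCohomology X 1) :
    conj (trC hX 4 (LinearMap.BilinMap.baseChange ℂ (cup X 2 2)
        (LinearMap.BilinMap.baseChange ℂ (cup X 1 1) β (Motives.HodgeStructure.conj γ)) ((1 : ℂ) ⊗ₜ[ℚ] ω))) =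
      -trC hX 4 (LinearMap.BilinMap.baseChange ℂ (cup X 2 2)
        (LinearMap.BilinMap.baseChange ℂ (cup X 1 1) γ (Motives.HodgeStructure.conj β)) ((1 : ℂ) ⊗ₜ[ℚ] ω)) := by
  rw [← trC_conj hX 4, conj_cupC 2, conj_cupC 1, Motives.HodgeStructure.conj_conj, conj_one_tmul,
    cupC_comm_one (Motives.HodgeStructure.conj β) γ, map_neg, LinearMap.neg_apply, map_neg]

/-- **Hermitian symmetry**: `B α β = conj (B β α)`. [cite: VoisinHodgeI2002, §6.3.2 Thm. 6.32] -/
theorem hrFormOne_symm (α β : ℂ ⊗[ℚ] bettiCohomology X 1) : B α β = conj (B β α) := by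
  obtain ⟨α₁, α₂, hα₁, hα₂, rfl⟩ := exists_decomp_one hHD hX α
  obtain ⟨β₁, β₂, hβ₁, hβ₂, rfl⟩ := exists_decomp_one hHD hX β
  rw [hB α₁ β₁ α₂ β₂ hα₁ hβ₁ hα₂ hβ₂, hB β₁ α₁ β₂ α₂ hβ₁ hα₁ hβ₂ hα₂]
  rw [map_sub, map_mul, map_mul, map_div₀, map_div₀, conj_trC_cup_one_tmul, conj_trC_cup_cup_conj hX ω,
    conj_trC_cup_cup_conj hX ω, Complex.conj_I]
  ring

/-- **Positive definiteness** (`0 < re (B α α)` for `α ≠ 0`): on `α = α₁ + α₂`, `B α α = i·t(α₁ ∪ ᾱ₁ ∪ ω) − i·t(α₂ ∪ ᾱ₂ ∪ ω)`;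
the first term is `> 0` for `α₁ ≠ 0` by Hodge–Riemann in bidegree `(1,0)` (`HodgeRiemann10_holds`), the second is
`+ i·t(ᾱ₂ ∪ α₂ ∪ ω) > 0` for `α₂ ≠ 0` by the same applied to `ᾱ₂ ∈ F¹` (anticommutativity), provided `ω` is a Kähler class.
[cite: VoisinHodgeI2002, §6.3.2 Thm. 6.32 (k = 1), Rem. 6.33] -/
theorem hrFormOne_posDef (hω : IsKaehlerClass 2 X (ofRatClass (Motives.ComplexPoints X) 2 ω))
    (α : ℂ ⊗[ℚ] bettiCohomology X 1) (hα : α ≠ 0) : 0 < (B α α).re := by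
  obtain ⟨α₁, α₂, hα₁, hα₂, rfl⟩ := exists_decomp_one hHD hX α
  have hc0 := trC_cup_self_ne_zero_of_isKaehlerClass hX ω hω
  -- the two Hodge–Riemann inequalities, as real numbers
  have h1 : ∃ s : ℝ, 0 ≤ s ∧ (α₁ ≠ 0 → 0 < s) ∧
      Complex.I * (trC hX 4 (LinearMap.BilinMap.baseChange ℂ (cup X 2 2)
        (LinearMap.BilinMap.baseChange ℂ (cup X 1 1) α₁ (Motives.HodgeStructure.conj α₁)) ((1 : ℂ) ⊗ₜ[ℚ] ω)) /
        trC hX 4 (LinearMap.BilinMap.baseChange ℂ (cup X 2 2) ((1 : ℂ) ⊗ₜ[ℚ] ω) ((1 : ℂ) ⊗ₜ[ℚ] ω))) = (s : ℂ) := by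
    by_cases h0 : α₁ = 0
    · refine ⟨0, le_rfl, fun h => absurd h0 h, ?_⟩
      subst h0
      simp
    · obtain ⟨s, hs, hse⟩ := hodgeRiemann_one_zero hHD HodgeRiemann10_holds hX rfl ω hω α₁ hα₁ h0
      refine ⟨s, hs.le, fun _ => hs, ?_⟩
      rw [mul_div_assoc', hse, mul_div_assoc, div_self hc0, mul_one]
  have h2 : ∃ s : ℝ, 0 ≤ s ∧ (α₂ ≠ 0 → 0 < s) ∧
      -(Complex.I * (trC hX 4 (LinearMap.BilinMap.baseChange ℂ (cup X 2 2)
        (LinearMap.BilinMap.baseChange ℂ (cup X 1 1) α₂ (Motives.HodgeStructure.conj α₂)) ((1 : ℂ) ⊗ₜ[ℚ] ω)) /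
        trC hX 4 (LinearMap.BilinMap.baseChange ℂ (cup X 2 2) ((1 : ℂ) ⊗ₜ[ℚ] ω) ((1 : ℂ) ⊗ₜ[ℚ] ω)))) = (s : ℂ) := by
    by_cases h0 : α₂ = 0
    · refine ⟨0, le_rfl, fun h => absurd h0 h, ?_⟩
      subst h0
      simp
    · -- `ᾱ₂ ∈ F¹`, non-zero
      have hα₂' : Motives.HodgeStructure.conj α₂ ∈ (hodge hHD hX 1).F 1 :=
        Motives.HodgeStructure.mem_complexConj.mp hα₂
      have h0' : Motives.HodgeStructure.conj α₂ ≠ 0 := fun h =>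
        h0 (by rw [← Motives.HodgeStructure.conj_conj α₂, h, map_zero])
      obtain ⟨s, hs, hse⟩ := hodgeRiemann_one_zero hHD HodgeRiemann10_holds hX rfl ω hω _ hα₂' h0'
      refine ⟨s, hs.le, fun _ => hs, ?_⟩
      -- `hse : I * tr(ᾱ₂ ∪ α₂ ∪ ω) = s * tr(ω∪ω)`; rewrite `ᾱ₂ ∪ α₂ = -(α₂ ∪ ᾱ₂)`
      rw [Motives.HodgeStructure.conj_conj, cupC_comm_one, map_neg, LinearMap.neg_apply, map_neg, mul_neg] at hse
      -- `hse : -(I * tr(α₂ ∪ ᾱ₂ ∪ ω)) = s * tr(ω∪ω)`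
      rw [mul_div_assoc', ← neg_div, hse, mul_div_assoc, div_self hc0, mul_one]
  obtain ⟨s₁, hs₁, hs₁', e₁⟩ := h1
  obtain ⟨s₂, hs₂, hs₂', e₂⟩ := h2
  rw [hB α₁ α₁ α₂ α₂ hα₁ hα₁ hα₂ hα₂, sub_eq_add_neg, e₁, e₂, ← Complex.ofReal_add, Complex.ofReal_re]
  -- `α ≠ 0` forces `α₁ ≠ 0` or `α₂ ≠ 0`
  by_cases h01 : α₁ = 0
  · have h02 : α₂ ≠ 0 := fun h => hα (by rw [h01, h, add_zero])
    exact add_pos_of_nonneg_of_pos hs₁ (hs₂' h02)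
  · exact add_pos_of_pos_of_nonneg (hs₁' h01) hs₂

end Properties

/-! ## §4 Functoriality under a morphism pulling the class back -/

/-- **The ω-normalised Hodge–Riemann form is EXACTLY functorial**: for a morphism `g : X' ⟶ X` of smooth projective surfaces
and the pulled-back class `ω' = g^*ω` (with `g^*ω` again Kähler-complexified, so that both normalisations make sense), the
forms `B = B_{X,ω}` and `B' = B_{X',g^*ω}` satisfy `B' (g^*α) (g^*β) = B α β` — `g^*` preserves the Hodge decomposition
([VoisinHodgeI2002, §7.3.2]; `pull_hodge`), cup products (`pull_cup`) and conjugation, and the normalised trace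
`t_{g^*Ω}(g^*η) = t_Ω(η)` (`trC_pull_div_eq`: the degree of `g` cancels).  This is what makes the level forms of the Picard
modular tower compatible with the level coverings and the Hecke translations without any weights at the component level.
[cite: VoisinHodgeI2002, §7.3.2 and §6.3.2 Thm. 6.32] [cite: HatcherAT2002, §3.2 Prop. 3.10] -/
theorem hrFormOne_pull (hHD : exists_isReal_hodgeModel) (hI : hodgePQ_independent_of_hodgeModel)
    (hX : Motives.IsSmoothProjective 2 X) (hX' : Motives.IsSmoothProjective 2 X') (g : X' ⟶ X) (ω : bettiCohomology X 2)
    (hω : IsKaehlerClass 2 X (ofRatClass (Motives.ComplexPoints X) 2 ω))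
    (hω' : IsKaehlerClass 2 X' (ofRatClass (Motives.ComplexPoints X') 2 (pull g 2 ω)))
    {B : (ℂ ⊗[ℚ] bettiCohomology X 1) →ₗ⋆[ℂ] (ℂ ⊗[ℚ] bettiCohomology X 1) →ₗ[ℂ] ℂ}
    (hB : ∀ (α₁ β₁ α₂ β₂ : ℂ ⊗[ℚ] bettiCohomology X 1), α₁ ∈ (hodge hHD hX 1).F 1 → β₁ ∈ (hodge hHD hX 1).F 1 →
      α₂ ∈ Motives.HodgeStructure.complexConj ((hodge hHD hX 1).F 1) →
      β₂ ∈ Motives.HodgeStructure.complexConj ((hodge hHD hX 1).F 1) →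
      B (α₁ + α₂) (β₁ + β₂) =
        Complex.I * (trC hX 4 (LinearMap.BilinMap.baseChange ℂ (cup X 2 2)
            (LinearMap.BilinMap.baseChange ℂ (cup X 1 1) β₁ (Motives.HodgeStructure.conj α₁)) ((1 : ℂ) ⊗ₜ[ℚ] ω)) /
          trC hX 4 (LinearMap.BilinMap.baseChange ℂ (cup X 2 2) ((1 : ℂ) ⊗ₜ[ℚ] ω) ((1 : ℂ) ⊗ₜ[ℚ] ω))) -
        Complex.I * (trC hX 4 (LinearMap.BilinMap.baseChange ℂ (cup X 2 2)
            (LinearMap.BilinMap.baseChange ℂ (cup X 1 1) β₂ (Motives.HodgeStructure.conj α₂)) ((1 : ℂ) ⊗ₜ[ℚ] ω)) /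
          trC hX 4 (LinearMap.BilinMap.baseChange ℂ (cup X 2 2) ((1 : ℂ) ⊗ₜ[ℚ] ω) ((1 : ℂ) ⊗ₜ[ℚ] ω))))
    {B' : (ℂ ⊗[ℚ] bettiCohomology X' 1) →ₗ⋆[ℂ] (ℂ ⊗[ℚ] bettiCohomology X' 1) →ₗ[ℂ] ℂ}
    (hB' : ∀ (α₁ β₁ α₂ β₂ : ℂ ⊗[ℚ] bettiCohomology X' 1), α₁ ∈ (hodge hHD hX' 1).F 1 → β₁ ∈ (hodge hHD hX' 1).F 1 →
      α₂ ∈ Motives.HodgeStructure.complexConj ((hodge hHD hX' 1).F 1) →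
      β₂ ∈ Motives.HodgeStructure.complexConj ((hodge hHD hX' 1).F 1) →
      B' (α₁ + α₂) (β₁ + β₂) =
        Complex.I * (trC hX' 4 (LinearMap.BilinMap.baseChange ℂ (cup X' 2 2)
            (LinearMap.BilinMap.baseChange ℂ (cup X' 1 1) β₁ (Motives.HodgeStructure.conj α₁)) ((1 : ℂ) ⊗ₜ[ℚ] pull g 2 ω)) /
          trC hX' 4 (LinearMap.BilinMap.baseChange ℂ (cup X' 2 2) ((1 : ℂ) ⊗ₜ[ℚ] pull g 2 ω) ((1 : ℂ) ⊗ₜ[ℚ] pull g 2 ω))) -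
        Complex.I * (trC hX' 4 (LinearMap.BilinMap.baseChange ℂ (cup X' 2 2)
            (LinearMap.BilinMap.baseChange ℂ (cup X' 1 1) β₂ (Motives.HodgeStructure.conj α₂)) ((1 : ℂ) ⊗ₜ[ℚ] pull g 2 ω)) /
          trC hX' 4 (LinearMap.BilinMap.baseChange ℂ (cup X' 2 2) ((1 : ℂ) ⊗ₜ[ℚ] pull g 2 ω) ((1 : ℂ) ⊗ₜ[ℚ] pull g 2 ω))))
    (α β : ℂ ⊗[ℚ] bettiCohomology X 1) :
    B' ((pull g 1).baseChange ℂ α) ((pull g 1).baseChange ℂ β) = B α β := by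
  obtain ⟨α₁, α₂, hα₁, hα₂, rfl⟩ := exists_decomp_one hHD hX α
  obtain ⟨β₁, β₂, hβ₁, hβ₂, rfl⟩ := exists_decomp_one hHD hX β
  -- `g^*` preserves both Hodge pieces
  have hF : ∀ x ∈ (hodge hHD hX 1).F 1, (pull g 1).baseChange ℂ x ∈ (hodge hHD hX' 1).F 1 := fun x hx =>
    pull_hodge hHD hI hX' hX g 1 1 (Submodule.mem_map_of_mem hx)
  have hcF : ∀ x ∈ Motives.HodgeStructure.complexConj ((hodge hHD hX 1).F 1),
      (pull g 1).baseChange ℂ x ∈ Motives.HodgeStructure.complexConj ((hodge hHD hX' 1).F 1) := fun x hx => by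
    rw [Motives.HodgeStructure.mem_complexConj, Motives.HodgeStructure.conj_baseChange]
    exact hF _ (Motives.HodgeStructure.mem_complexConj.mp hx)
  rw [map_add ((pull g 1).baseChange ℂ) α₁ α₂, map_add ((pull g 1).baseChange ℂ) β₁ β₂,
    hB' _ _ _ _ (hF α₁ hα₁) (hF β₁ hβ₁) (hcF α₂ hα₂) (hcF β₂ hβ₂), hB α₁ β₁ α₂ β₂ hα₁ hβ₁ hα₂ hβ₂]
  -- move `g^*` through `conj`, the two cup products and `1 ⊗ ω`, then apply the normalised-trace compatibility
  have hω1 : ((1 : ℂ) ⊗ₜ[ℚ] pull g 2 ω) = (pull g 2).baseChange ℂ ((1 : ℂ) ⊗ₜ[ℚ] ω) := by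
    rw [LinearMap.baseChange_tmul]
  have hcup : ∀ x y : ℂ ⊗[ℚ] bettiCohomology X 1,
      LinearMap.BilinMap.baseChange ℂ (cup X' 2 2)
          (LinearMap.BilinMap.baseChange ℂ (cup X' 1 1) ((pull g 1).baseChange ℂ y)
            (Motives.HodgeStructure.conj ((pull g 1).baseChange ℂ x))) ((1 : ℂ) ⊗ₜ[ℚ] pull g 2 ω) =
        (pull g 4).baseChange ℂ (LinearMap.BilinMap.baseChange ℂ (cup X 2 2)
          (LinearMap.BilinMap.baseChange ℂ (cup X 1 1) y (Motives.HodgeStructure.conj x)) ((1 : ℂ) ⊗ₜ[ℚ] ω)) := by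
    intro x y
    rw [Motives.HodgeStructure.conj_baseChange, hω1, ← pullC_cupC g 1 y, ← pullC_cupC g 2]
  have hden : (pull g 4).baseChange ℂ (LinearMap.BilinMap.baseChange ℂ (cup X 2 2) ((1 : ℂ) ⊗ₜ[ℚ] ω) ((1 : ℂ) ⊗ₜ[ℚ] ω)) =
      LinearMap.BilinMap.baseChange ℂ (cup X' 2 2) ((1 : ℂ) ⊗ₜ[ℚ] pull g 2 ω) ((1 : ℂ) ⊗ₜ[ℚ] pull g 2 ω) := by
    rw [hω1, ← pullC_cupC g 2]
  have hc0 := trC_cup_self_ne_zero_of_isKaehlerClass hX ω hω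
  have hc0' := trC_cup_self_ne_zero_of_isKaehlerClass hX' (pull g 2 ω) hω'
  rw [← hden] at hc0'
  rw [hcup, hcup, ← hden]
  have key : ∀ η : ℂ ⊗[ℚ] bettiCohomology X 4,
      trC hX' 4 ((pull g 4).baseChange ℂ η) /
          trC hX' 4 ((pull g 4).baseChange ℂ
            (LinearMap.BilinMap.baseChange ℂ (cup X 2 2) ((1 : ℂ) ⊗ₜ[ℚ] ω) ((1 : ℂ) ⊗ₜ[ℚ] ω))) =
        trC hX 4 η / trC hX 4 (LinearMap.BilinMap.baseChange ℂ (cup X 2 2) ((1 : ℂ) ⊗ₜ[ℚ] ω) ((1 : ℂ) ⊗ₜ[ℚ] ω)) :=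
    fun η => trC_pull_div_eq (n := 2) hX hX' g hc0 hc0' η
  rw [key, key]

/-! ## §5 The package -/

/-- **The Hodge–Riemann Hermitian form on `H¹` of a smooth projective surface with a rational Kähler class**: there is a sesquilinear
form `B` on `ℂ ⊗_ℚ H¹(X(ℂ); ℚ)`, given by the ω-normalised Hodge–Riemann formula on Hodge-decomposed vectors, which is Hermitian and
positive definite. [cite: VoisinHodgeI2002, §6.3.2 Thm. 6.32 (k = 1), Rem. 6.33; §7.1.1] -/
theorem exists_hermitian_posDef_hrFormOne (hHD : exists_isReal_hodgeModel) (hX : Motives.IsSmoothProjective 2 X)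
    (ω : bettiCohomology X 2) (hω : IsKaehlerClass 2 X (ofRatClass (Motives.ComplexPoints X) 2 ω)) :
    ∃ B : (ℂ ⊗[ℚ] bettiCohomology X 1) →ₗ⋆[ℂ] (ℂ ⊗[ℚ] bettiCohomology X 1) →ₗ[ℂ] ℂ,
      (∀ (α₁ β₁ α₂ β₂ : ℂ ⊗[ℚ] bettiCohomology X 1), α₁ ∈ (hodge hHD hX 1).F 1 → β₁ ∈ (hodge hHD hX 1).F 1 →
        α₂ ∈ Motives.HodgeStructure.complexConj ((hodge hHD hX 1).F 1) →
        β₂ ∈ Motives.HodgeStructure.complexConj ((hodge hHD hX 1).F 1) →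
        B (α₁ + α₂) (β₁ + β₂) =
          Complex.I * (trC hX 4 (LinearMap.BilinMap.baseChange ℂ (cup X 2 2)
              (LinearMap.BilinMap.baseChange ℂ (cup X 1 1) β₁ (Motives.HodgeStructure.conj α₁)) ((1 : ℂ) ⊗ₜ[ℚ] ω)) /
            trC hX 4 (LinearMap.BilinMap.baseChange ℂ (cup X 2 2) ((1 : ℂ) ⊗ₜ[ℚ] ω) ((1 : ℂ) ⊗ₜ[ℚ] ω))) -
          Complex.I * (trC hX 4 (LinearMap.BilinMap.baseChange ℂ (cup X 2 2)
              (LinearMap.BilinMap.baseChange ℂ (cup X 1 1) β₂ (Motives.HodgeStructure.conj α₂)) ((1 : ℂ) ⊗ₜ[ℚ] ω)) /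
            trC hX 4 (LinearMap.BilinMap.baseChange ℂ (cup X 2 2) ((1 : ℂ) ⊗ₜ[ℚ] ω) ((1 : ℂ) ⊗ₜ[ℚ] ω)))) ∧
      (∀ α β, B α β = conj (B β α)) ∧ (∀ α, α ≠ 0 → 0 < (B α α).re) := by
  obtain ⟨B, hB⟩ := exists_hrFormOne hHD hX ω
  exact ⟨B, hB, hrFormOne_symm hX ω hB, hrFormOne_posDef hX ω hB hω⟩

end BettiUniverse

end Literature.AlgebraicGeometry.HodgeTheory

end
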